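import Summits.AtomisticToContinuum.Crystallization.Theses.PricedLinkCensus
import Summits.AtomisticToContinuum.Crystallization.Theorems.PricedLinkCensusChargeFreeWindows
import Literature.MathematicalPhysics.StatisticalMechanics.LennardJonesClusters

/-!
# `StackingHinge` (stmt-AtomisticToContinuum-14993), negative side I: the structure of a kill, and
# the scale is load-bearing

Negative lemmas of the standing disprover of the crux `StackingHinge`
(`= SoftLayerPropagation → ChargeFreeWindows → GroundStatesChargePeriodic`, route PricedLinkCensus),
extracted from `Cruxes/StackingHinge/Disproof.lean` §1–§2; no positive route statement is concluded.

* §1 `not_stackingHinge_iff`: `¬ StackingHinge ↔ SoftLayerPropagation ∧ ZeroChargeBulk ∧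
  ¬ GroundStatesChargePeriodic` (through the in-tree `chargeFreeWindows_iff_zeroChargeBulk`): an
  unconditional refutation of the crux must prove the crux `SoftLayerPropagation` (14233) and the
  route target `ZeroChargeBulk` (14229) and disprove the shared hinge 2911.
* §2 SCALE IS LOAD-BEARING.  The second antecedent (charge-free windows a.e.) and `IsChargeFree` are
  invariant under an independent rescaling `x N ↦ c_N • x N` of every member of a sequence
  (`windowBadCard_smul`), while the consequent pins an absolute length — the period lattice of `Q`,
  compared through a linear ISOMETRY at tolerance `ε`: `ChargesPeriodic x` fails whenever the `N`-th
  member is `N`-separated (`not_chargesPeriodic_of_sparse`), and every injective sequence has such a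
  rescaling (`exists_rescaling_not_chargesPeriodic`).  Hence the hinge with the class of Lennard-Jones
  ground-state sequences replaced by a class closed under per-`N` rescalings and containing one
  injective sequence with charge-free windows a.e. is FALSE (`hingeOver_rescalings_false`,
  `StackingHinge ↔ HingeOver (ground states)` being `stackingHinge_iff_hingeOver`); granted the route
  target `ZeroChargeBulk`, rescaled ground states form such a class
  (`stackingHinge_false_without_scale`, `not_forall_hingeOver`).  Reading for provers: step (c) of
  the plan, "the common scale", must use a property of `IsGroundState lennardJones` that is not
  scale-invariant (the uniform nearest-neighbour bounds); charge-free windows and soft layer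
  propagation alone cannot supply it.

All `[folklore]`.
-/

noncomputable section

namespace Summit.AtomisticToContinuum.Crystallization.Theorems.StackingHingeNegative

open Summit.AtomisticToContinuum.Crystallization.Theses.PricedLinkCensus
open Summit.AtomisticToContinuum.Crystallization.Theorems
open Literature.MathematicalPhysics.StatisticalMechanics Literature.Geometry.DiscreteGeometry
open Filter Topology

/-! ## §1 Structure of the crux: what a refutation would have to contain -/

/-- The crux unfolded: `SoftLayerPropagation → ChargeFreeWindows → GroundStatesChargePeriodic`
(all three are route decls; the antecedent and consequent are inlined verbatim in the crux). [folklore] -/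
theorem stackingHinge_iff :
    StackingHinge ↔ (SoftLayerPropagation → ChargeFreeWindows → GroundStatesChargePeriodic) :=
  Iff.rfl

/-- **What a kill must contain.**  `¬ StackingHinge` is equivalent to: soft layer propagation holds
(crux 14233), the route TARGET `ZeroChargeBulk` holds (14229; `ChargeFreeWindows ↔ ZeroChargeBulk` is
the in-tree `chargeFreeWindows_iff_zeroChargeBulk`), and the shared hinge 2911 FAILS.  So the crux is
false only in a world where Lennard-Jones ground states ARE asymptotically charge-free (locally
Barlow at `1 %`) and yet charge no periodic configuration — persistent stacking disorder, strain at a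
fixed wavelength, or no common scale, along actual ground states. [folklore] -/
theorem not_stackingHinge_iff :
    ¬ StackingHinge ↔ SoftLayerPropagation ∧ ZeroChargeBulk ∧ ¬ GroundStatesChargePeriodic := by
  rw [stackingHinge_iff, chargeFreeWindows_iff_zeroChargeBulk]
  tauto

/-! ## §2 Scale is load-bearing: the hinge over rescaling-closed classes is false -/

/-- The consequent of the hinge for ONE sequence `x`: some periodic `Q` is charged with positive
upper density at every window `(R, ε)` (verbatim the body of `GroundStatesChargePeriodic`). [folklore] -/
def ChargesPeriodic (x : (N : ℕ) → (Fin N → (EuclideanSpace ℝ (Fin 3)))) : Prop :=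
  ∃ Q : PeriodicConfiguration 3, ∀ R ε : ℝ, 0 < R → 0 < ε → ∃ ρ : ℝ, 0 < ρ ∧
    ∃ᶠ N : ℕ in atTop, ρ * (N : ℝ) ≤ (Nat.card {i : Fin N // ∃ A : (EuclideanSpace ℝ (Fin 3)) →ₗᵢ[ℝ] (EuclideanSpace ℝ (Fin 3)), ∃ q ∈ Q.points,
      (∀ s ∈ Q.points, dist s q ≤ R → ∃ j : Fin N, dist (x N j) (x N i + A (s - q)) ≤ ε) ∧
      (∀ j : Fin N, dist (x N j) (x N i) ≤ R →
        ∃ s ∈ Q.points, dist (x N j) (x N i + A (s - q)) ≤ ε)} : ℝ)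

/-- `GroundStatesChargePeriodic` is `ChargesPeriodic` along every sequence of ground states. [folklore] -/
theorem groundStatesChargePeriodic_iff :
    GroundStatesChargePeriodic ↔ ∀ x : (N : ℕ) → (Fin N → (EuclideanSpace ℝ (Fin 3))),
      (∀ N, IsGroundState lennardJones (x N)) → ChargesPeriodic x :=
  Iff.rfl

/-- The size of the exceptional set of `ChargeFreeWindows` at radius `R` for one configuration:
sites `i` having a site within `R · nn_i` that is not charge-free at `1/100`. [folklore] -/
def windowBadCard (R : ℝ) {N : ℕ} (y : Fin N → (EuclideanSpace ℝ (Fin 3))) : ℕ :=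
  Nat.card {i : Fin N // ¬ ∀ j : Fin N, dist (y i) (y j) ≤ R * nearestDist y i →
    IsChargeFree (1 / 100 : ℝ) y j}

/-- Charge-free windows almost everywhere along ONE sequence. [folklore] -/
def WindowsAE (x : (N : ℕ) → (Fin N → (EuclideanSpace ℝ (Fin 3)))) : Prop :=
  ∀ R : ℝ, 0 < R → Tendsto (fun N : ℕ => (windowBadCard R (x N) : ℝ) / N) atTop (𝓝 0)

/-- The hinge with the class of Lennard-Jones ground-state sequences replaced by an arbitrary class
`𝒞` of sequences of finite configurations. [folklore] -/
def HingeOver (𝒞 : ((N : ℕ) → (Fin N → (EuclideanSpace ℝ (Fin 3)))) → Prop) : Prop :=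
  SoftLayerPropagation →
    (∀ R : ℝ, 0 < R → ∀ x : (N : ℕ) → (Fin N → (EuclideanSpace ℝ (Fin 3))), 𝒞 x →
      Tendsto (fun N : ℕ => (windowBadCard R (x N) : ℝ) / N) atTop (𝓝 0)) →
    ∀ x : (N : ℕ) → (Fin N → (EuclideanSpace ℝ (Fin 3))), 𝒞 x → ChargesPeriodic x

/-- The crux is the hinge over the class of Lennard-Jones ground-state sequences (definitionally). [folklore] -/
theorem stackingHinge_iff_hingeOver :
    StackingHinge ↔ HingeOver (fun x => ∀ N, IsGroundState lennardJones (x N)) :=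
  Iff.rfl

/-- **Rescaling invariance of the antecedent.**  The exceptional set of `ChargeFreeWindows` is
unchanged by `y ↦ c • y` (`c ≠ 0`): distances and nearest-neighbour distances scale by `‖c‖` and
charge-freeness is scale-invariant (`isChargeFree_smul_iff`). [folklore] -/
theorem windowBadCard_smul {c : ℝ} (hc : c ≠ 0) (R : ℝ) {N : ℕ} (y : Fin N → (EuclideanSpace ℝ (Fin 3))) :
    windowBadCard R (c • y) = windowBadCard R y := by
  unfold windowBadCard
  refine Nat.card_congr (Equiv.subtypeEquivRight fun i => ?_)
  have hc' : 0 < ‖c‖ := norm_pos_iff.2 hc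
  simp only [Pi.smul_apply, dist_smul₀, nearestDist_smul, isChargeFree_smul_iff hc]
  refine not_congr (forall_congr' fun j => ?_)
  rw [mul_left_comm, mul_le_mul_iff_right₀ hc']

/-- A full-rank lattice in `ℝ³` has a non-zero vector. [folklore] -/
theorem exists_mem_lattice_ne_zero (Q : PeriodicConfiguration 3) : ∃ g ∈ Q.lattice, g ≠ 0 := by
  by_contra h
  push Not at h
  have hsub : (Q.lattice : Set (EuclideanSpace ℝ (Fin 3))) ⊆ {(0 : (EuclideanSpace ℝ (Fin 3)))} := fun g hg => h g hg
  have h1 : Submodule.span ℝ (Q.lattice : Set (EuclideanSpace ℝ (Fin 3))) ≤ Submodule.span ℝ {(0 : (EuclideanSpace ℝ (Fin 3)))} :=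
    Submodule.span_mono hsub
  rw [Q.isZLattice.span_top, Submodule.span_zero_singleton] at h1
  have hmem : (EuclideanSpace.single (0 : Fin 3) (1 : ℝ) : (EuclideanSpace ℝ (Fin 3))) ∈ (⊥ : Submodule ℝ (EuclideanSpace ℝ (Fin 3))) :=
    h1 Submodule.mem_top
  rw [Submodule.mem_bot] at hmem
  have := congrArg (fun v : (EuclideanSpace ℝ (Fin 3)) => v 0) hmem
  simp at this

/-- **The consequent is not scale-free.**  If the `N`-th configuration is `N`-separated
(`dist (x N i) (x N j) ≥ N` for `i ≠ j`), then NO periodic `Q` is charged: take a non-zero period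
`g` of `Q`, the window `R = ‖g‖`, `ε = ‖g‖/4`; a good site `i` (there is one, the good set having
positive density for infinitely many `N`) must see a site `ε`-close to `x N i + A g`, which is
neither `i` itself (`‖A g‖ = ‖g‖ > ε`) nor another site (those are `≥ N > ‖g‖ + ε` away). [folklore] -/
theorem not_chargesPeriodic_of_sparse (x : (N : ℕ) → (Fin N → (EuclideanSpace ℝ (Fin 3))))
    (hx : ∀ (N : ℕ) (i j : Fin N), i ≠ j → (N : ℝ) ≤ dist (x N i) (x N j)) :
    ¬ ChargesPeriodic x := by
  rintro ⟨Q, hQ⟩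
  obtain ⟨g, hg, hg0⟩ := exists_mem_lattice_ne_zero Q
  have hR : 0 < ‖g‖ := norm_pos_iff.2 hg0
  obtain ⟨ρ, hρ, hfr⟩ := hQ ‖g‖ (‖g‖ / 4) hR (by positivity)
  obtain ⟨N, hgood, hN⟩ := (hfr.and_eventually (eventually_gt_atTop ⌈2 * ‖g‖⌉₊)).exists
  have hN' : 2 * ‖g‖ < N := (Nat.le_ceil _).trans_lt (by exact_mod_cast hN)
  have hNpos : (0 : ℝ) < N := by linarith
  have hpos : 0 < Nat.card {i : Fin N // ∃ A : (EuclideanSpace ℝ (Fin 3)) →ₗᵢ[ℝ] (EuclideanSpace ℝ (Fin 3)), ∃ q ∈ Q.points,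
      (∀ s ∈ Q.points, dist s q ≤ ‖g‖ → ∃ j : Fin N, dist (x N j) (x N i + A (s - q)) ≤ ‖g‖ / 4) ∧
      (∀ j : Fin N, dist (x N j) (x N i) ≤ ‖g‖ →
        ∃ s ∈ Q.points, dist (x N j) (x N i + A (s - q)) ≤ ‖g‖ / 4)} := by
    have : (0 : ℝ) < Nat.card _ := (mul_pos hρ hNpos).trans_le hgood
    exact_mod_cast this
  obtain ⟨⟨i, A, q, hq, h1, -⟩⟩ := (Nat.card_pos_iff.1 hpos).1
  obtain ⟨j, hj⟩ := h1 (q + g) (Q.add_mem_points hq hg)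
    (by rw [dist_eq_norm, add_sub_cancel_left])
  rw [add_sub_cancel_left] at hj
  have hAg : ‖A g‖ = ‖g‖ := A.norm_map g
  by_cases hji : j = i
  · subst hji
    rw [dist_comm, dist_eq_norm, add_sub_cancel_left, hAg] at hj
    linarith
  · have h3 := hx N j i hji
    have h4 : dist (x N j) (x N i) ≤ dist (x N j) (x N i + A g) + dist (x N i + A g) (x N i) :=
      dist_triangle _ _ _
    rw [dist_eq_norm (x N i + A g), add_sub_cancel_left, hAg] at h4
    linarith

/-- A finite injective configuration has a positive minimal distance. [folklore] -/
theorem exists_pos_le_dist {N : ℕ} {y : Fin N → (EuclideanSpace ℝ (Fin 3))} (hy : Function.Injective y) :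
    ∃ m : ℝ, 0 < m ∧ ∀ i j : Fin N, i ≠ j → m ≤ dist (y i) (y j) := by
  classical
  let S : Finset ℝ := (Finset.univ.filter fun p : Fin N × Fin N => p.1 ≠ p.2).image
    fun p => dist (y p.1) (y p.2)
  have hmem : ∀ i j : Fin N, i ≠ j → dist (y i) (y j) ∈ S := fun i j hij =>
    Finset.mem_image.2 ⟨(i, j), Finset.mem_filter.2 ⟨Finset.mem_univ _, hij⟩, rfl⟩
  by_cases hne : S.Nonempty
  · refine ⟨S.min' hne, ?_, fun i j hij => S.min'_le _ (hmem i j hij)⟩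
    obtain ⟨p, hp, hpeq⟩ := Finset.mem_image.1 (S.min'_mem hne)
    rw [← hpeq]
    exact dist_pos.2 (hy.ne (Finset.mem_filter.1 hp).2)
  · exact ⟨1, one_pos, fun i j hij => absurd ⟨_, hmem i j hij⟩ hne⟩

/-- **Every injective sequence has a rescaling that charges no periodic configuration**: blow the
`N`-th member up until it is `N`-separated. [folklore] -/
theorem exists_rescaling_not_chargesPeriodic (x : (N : ℕ) → (Fin N → (EuclideanSpace ℝ (Fin 3))))
    (hx : ∀ N, Function.Injective (x N)) :
    ∃ c : ℕ → ℝ, (∀ N, 0 < c N) ∧ ¬ ChargesPeriodic (fun N => c N • x N) := by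
  choose m hm hmle using fun N => exists_pos_le_dist (hx N)
  refine ⟨fun N => N / m N + 1, fun N => by have := hm N; positivity,
    not_chargesPeriodic_of_sparse _ fun N i j hij => ?_⟩
  show (N : ℝ) ≤ dist ((N / m N + 1) • x N i) ((N / m N + 1) • x N j)
  have hc : (0 : ℝ) ≤ N / m N + 1 := by have := hm N; positivity
  rw [dist_smul₀, Real.norm_of_nonneg hc]
  calc (N : ℝ) ≤ N + m N := le_add_of_nonneg_right (hm N).le
    _ = (N / m N + 1) * m N := by rw [add_mul, div_mul_cancel₀ _ (hm N).ne', one_mul]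
    _ ≤ (N / m N + 1) * dist (x N i) (x N j) := mul_le_mul_of_nonneg_left (hmle N i j hij) hc

/-- The class of per-`N` rescalings of a fixed sequence `x₀`. [folklore] -/
def Rescalings (x₀ : (N : ℕ) → (Fin N → (EuclideanSpace ℝ (Fin 3)))) (x : (N : ℕ) → (Fin N → (EuclideanSpace ℝ (Fin 3)))) : Prop :=
  ∃ c : ℕ → ℝ, (∀ N, 0 < c N) ∧ x = fun N => c N • x₀ N

/-- `x₀` is a rescaling of itself. [folklore] -/
theorem rescalings_self (x₀ : (N : ℕ) → (Fin N → (EuclideanSpace ℝ (Fin 3)))) : Rescalings x₀ x₀ :=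
  ⟨fun _ => 1, fun _ => one_pos, by funext N; rw [one_smul]⟩

/-- The antecedent passes to the whole rescaling class. [folklore] -/
theorem windows_of_rescalings {x₀ : (N : ℕ) → (Fin N → (EuclideanSpace ℝ (Fin 3)))} (hW : WindowsAE x₀) :
    ∀ R : ℝ, 0 < R → ∀ x : (N : ℕ) → (Fin N → (EuclideanSpace ℝ (Fin 3))), Rescalings x₀ x →
      Tendsto (fun N : ℕ => (windowBadCard R (x N) : ℝ) / N) atTop (𝓝 0) := by
  rintro R hR x ⟨c, hc, rfl⟩
  have : (fun N : ℕ => (windowBadCard R (c N • x₀ N) : ℝ) / N) =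
      fun N : ℕ => (windowBadCard R (x₀ N) : ℝ) / N :=
    funext fun N => by rw [windowBadCard_smul (hc N).ne']
  rw [this]
  exact hW R hR

/-- The consequent fails somewhere in the rescaling class of any injective sequence. [folklore] -/
theorem not_forall_rescalings_chargesPeriodic {x₀ : (N : ℕ) → (Fin N → (EuclideanSpace ℝ (Fin 3)))}
    (hinj : ∀ N, Function.Injective (x₀ N)) :
    ¬ ∀ x : (N : ℕ) → (Fin N → (EuclideanSpace ℝ (Fin 3))), Rescalings x₀ x → ChargesPeriodic x := by
  intro h
  obtain ⟨c, hc, hnot⟩ := exists_rescaling_not_chargesPeriodic x₀ hinj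
  exact hnot (h _ ⟨c, hc, rfl⟩)

/-- **Scale is load-bearing (class form).**  For every injective sequence `x₀` with charge-free
windows a.e., the hinge over the rescaling class of `x₀` is false (given the first antecedent
`SoftLayerPropagation`, which is a closed statement): the second antecedent holds throughout the
class, the consequent fails in it. [folklore] -/
theorem hingeOver_rescalings_false {x₀ : (N : ℕ) → (Fin N → (EuclideanSpace ℝ (Fin 3)))}
    (hinj : ∀ N, Function.Injective (x₀ N)) (hW : WindowsAE x₀) (hSLP : SoftLayerPropagation) :
    ¬ HingeOver (Rescalings x₀) := fun h =>
  not_forall_rescalings_chargesPeriodic hinj (h hSLP (windows_of_rescalings hW))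

/-- The same with BOTH uses of the class spelled out and no appeal to `SoftLayerPropagation`: the
implication "charge-free windows a.e. on the class ⇒ periodic charge on the class" fails. [folklore] -/
theorem windows_not_imp_chargesPeriodic {x₀ : (N : ℕ) → (Fin N → (EuclideanSpace ℝ (Fin 3)))}
    (hinj : ∀ N, Function.Injective (x₀ N)) (hW : WindowsAE x₀) :
    (∀ R : ℝ, 0 < R → ∀ x : (N : ℕ) → (Fin N → (EuclideanSpace ℝ (Fin 3))), Rescalings x₀ x →
        Tendsto (fun N : ℕ => (windowBadCard R (x N) : ℝ) / N) atTop (𝓝 0)) ∧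
      ¬ ∀ x : (N : ℕ) → (Fin N → (EuclideanSpace ℝ (Fin 3))), Rescalings x₀ x → ChargesPeriodic x :=
  ⟨windows_of_rescalings hW, not_forall_rescalings_chargesPeriodic hinj⟩

/-- **`StackingHinge` is false without the scale information carried by `IsGroundState`.**  Granted
the route's own target `ZeroChargeBulk` (equivalently `ChargeFreeWindows`), take an actual sequence
of Lennard-Jones ground states `x₀` (`LennardJonesGroundStatesExist_holds`): its rescaling class
satisfies the second antecedent of the hinge at every radius, contains `x₀`, and contains a sequence
charging no periodic configuration.  Any proof of the crux must therefore use a property of ground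
states that separates `x₀` from its rescalings — an absolute length scale. [folklore] -/
theorem stackingHinge_false_without_scale (hZ : ZeroChargeBulk) :
    ∃ x₀ : (N : ℕ) → (Fin N → (EuclideanSpace ℝ (Fin 3))), (∀ N, IsGroundState lennardJones (x₀ N)) ∧
      (∀ R : ℝ, 0 < R → ∀ x : (N : ℕ) → (Fin N → (EuclideanSpace ℝ (Fin 3))), Rescalings x₀ x →
          Tendsto (fun N : ℕ => (windowBadCard R (x N) : ℝ) / N) atTop (𝓝 0)) ∧
      ¬ ∀ x : (N : ℕ) → (Fin N → (EuclideanSpace ℝ (Fin 3))), Rescalings x₀ x → ChargesPeriodic x := by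
  choose x₀ hx₀ using LennardJonesGroundStatesExist_holds
  have hW : WindowsAE x₀ := fun R hR => (chargeFreeWindows_iff_zeroChargeBulk.2 hZ) R hR x₀ hx₀
  exact ⟨x₀, hx₀, windows_not_imp_chargesPeriodic (fun N => (hx₀ N).1) hW⟩

/-- Corollary: the "purely geometric hinge" (the crux for EVERY class of sequences) is false as soon
as the two other open items of the route hold. [folklore] -/
theorem not_forall_hingeOver (hSLP : SoftLayerPropagation) (hZ : ZeroChargeBulk) :
    ¬ ∀ 𝒞 : ((N : ℕ) → (Fin N → (EuclideanSpace ℝ (Fin 3)))) → Prop, HingeOver 𝒞 := by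
  intro h
  obtain ⟨x₀, hx₀, -, hnot⟩ := stackingHinge_false_without_scale hZ
  have hW : WindowsAE x₀ := fun R hR => (chargeFreeWindows_iff_zeroChargeBulk.2 hZ) R hR x₀ hx₀
  exact hingeOver_rescalings_false (fun N => (hx₀ N).1) hW hSLP (h _)

end Summit.AtomisticToContinuum.Crystallization.Theorems.StackingHingeNegative

end
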